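import Literature.NumberTheory.EllipticCurves.DivisionValuesNonsingularReductionProofs
import Literature.NumberTheory.EllipticCurves.CanonicalPAdicHeightIntegralityProofs
import Literature.NumberTheory.EllipticCurves.CanonicalPAdicHeightAdmissibilityCriteria
import Literature.NumberTheory.EllipticCurves.CanonicalPAdicHeightNumeratorProofs
import HarnessLib

/-!
# The sigma formula for the canonical `p`-adic height of `n • P` in division values
# (`ĥ_p(nP) = log_p ψₙ(P)² − 2 log_p σ_p(−φₙ(P)ψₙ(P)/ωₙ(P))`; proofs only)

Topic `NumberTheory/EllipticCurves`; a proofs-only companion of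
`DivisionValuesNonsingularReductionProofs` (Ayad's lemma, the exact denominator `den x(nP) = ψₙ(P)²`)
and of the canonical-height files `CanonicalPAdicHeight*`. No definition, no named fact.

Let `V` be an integral Weierstrass model over `ℤ`, `E = V ⊗ ℚ`, `P = (a, b)` an INTEGRAL point and
`n` with `ψₙ(P) ≠ 0`. Step 1 of the Mazur–Stein–Tate algorithm for the cyclotomic `p`-adic height
(Mazur–Stein–Tate 2006, Alg. 3.4: replace `P` by `Q = mP` reducing to `O` mod `p` and into the
connected components, `d = √den x(Q)`, `s = σ_p(−x/y)`, `h_p(Q) = (1/p) log_p(s/d)`; tree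
normalisation `ĥ_p = log_p den x − 2 log_p σ_p(z)`, `WeierstrassCurve.canonicalPAdicHeight`) is made
EXPLICIT in the division values `φₙ(P), ψₙ(P), ωₙ(P) ∈ ℤ` (Silverman *AEC* Ex. 3.7:
`nP = (φₙ/ψₙ², ωₙ/ψₙ³)`), for points `P` with non-singular reduction — the situation of a family
sieved to square-free discriminant, where EVERY rational point reduces non-singularly
(`WeierstrassCurve.nonsingularReductionSubgroupAt_eq_top_of_lt_norm_Δ`):

* `hasNonsingularReductionAt_of_not_sq_dvd_Δ` — `ℓ² ∤ Δ(V)` ⇒ every rational point of `E` has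
  non-singular reduction at `ℓ` (point-level form of the subgroup statement);
* `ωEval_map_intCast`, `Affine.Point.zsmul_some_intCast_eq` — `n • P = (φₙ(P)/ψₙ(P)², ωₙ(P)/ψₙ(P)³)`
  with the INTEGER division values `(V.φ n).evalEval a b`, `(V.ψ n).evalEval a b`,
  `UnivEC.ev V a b (UnivEC.ω n)`;
* `num_φ_div_ψ_sq_eq` — the exact NUMERATOR `num x(nP) = φₙ(P)` (companion of the exact denominator
  `Affine.Point.exists_zsmul_eq_and_den_eq_sq`: `φₙ(P) ⊥ ψₙ(P)` by Ayad's lemma);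
* at a prime `p ∣ ψₙ(P)` (i.e. `nP ≡ O mod p`): `norm_intCast_φ_eq_one_of_dvd_ψ` (`φₙ(P), ωₙ(P)` are
  `p`-adic units), `norm_x_zsmul_eq` (`‖x(nP)‖_p = ‖ψₙ(P)‖_p⁻² > 1`), `padicParam_zsmul_eq`
  (`z(nP) = −x/y = −φₙψₙ/ωₙ`, `‖z(nP)‖_p = ‖ψₙ(P)‖_p`: Stange 2016 §5, proof of Thm. 12);
* `isAdmissible_zsmul_of_dvd_ψ` — for `p ≥ 3` and `Δ(V)` not divisible by the square of any prime,
  `nP` is ADMISSIBLE for the sigma formula (`WeierstrassCurve.IsAdmissible`);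
* `pairing_zsmul_self_eq_of_isCanonical` — for THE canonical datum `D` (`PAdicHeightData.IsCanonical`):
  `⟨nP, nP⟩_D = log_p(ψₙ(P)²) − 2 log_p σ_p(−φₙ(P)ψₙ(P)/ωₙ(P))`, and `sq_mul_pairing_self_eq`:
  `n² ⟨P, P⟩_D = ⟨nP, nP⟩_D`; first-order corollary `norm_pairing_zsmul_self_sub_padicLog_φ_le`:
  `‖⟨nP, nP⟩_D − log_p φₙ(P)‖_p ≤ ‖ψₙ(P)‖_p` (`p` odd).

## References
* [MazurSteinTate2006] B. Mazur, W. Stein, J. Tate, *Computation of p-adic heights and log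
  convergence*, Doc. Math. Extra Vol. Coates (2006), §1 eq. (1.1), Alg. 3.4 (steps 1–4).
* [Stange2016] K. E. Stange, *Integral points on elliptic curves and explicit valuations of division
  polynomials*, Canad. J. Math. 68 (2016), §5 proof of Thm. 12 (`v(Θ([n]P)) = v(−φₙψₙ/ωₙ) = v(Ψₙ)`).
* [Harvey2008] D. Harvey, *Efficient computation of p-adic heights*, LMS J. Comput. Math. 11 (2008),
  §5 (evaluation of `log_p(σ_p(mQ)/d(mQ))`).
* [SilvermanAEC2009] J. H. Silverman, *The Arithmetic of Elliptic Curves*, 2nd ed., Ex. 3.7(d), VII.2.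

## Design
Integers throughout: the division values are the integers `(V.ψ n).evalEval a b`, `(V.φ n).evalEval a b`,
`UnivEC.ev V a b (UnivEC.ω n)`, cast into `ℚ` and `ℚ_p` (dictionary `evalEval_ψ_map_intCast`,
`evalEval_φ_map_intCast`, `ωEval_map_intCast`). The reduction hypothesis is the coordinate predicate
`HasNonsingularReductionAt` of the height files; the sieve hypothesis is `¬ ℓ² ∣ Δ(V)` prime by prime
(the shape of `BhargavaHo2022.CongruenceFamily₂.IsLargeAt`). Nothing here needs minimality or
good/ordinary reduction: those enter only through `IsCanonical`.
-/

noncomputable section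

open scoped Classical
open Literature.NumberTheory.EllipticCurves

namespace WeierstrassCurve

/-! ### Square-free discriminant ⇒ every rational point reduces non-singularly -/

section Sieve

variable (V : WeierstrassCurve ℤ) (ℓ : ℕ) [Fact ℓ.Prime]

/-- **`ℓ² ∤ Δ(V)` ⇒ every rational point of `V ⊗ ℚ` has non-singular reduction modulo `ℓ`** (reduction
types I₀, I₁ only: `E(ℚ) = E(ℚ) ∩ E⁰(ℚ_ℓ)`), the point-level form of
`nonsingularReductionSubgroupAt_eq_top_of_lt_norm_Δ`. [cite: SilvermanAEC2009, VII.2.1 and VII.6.1] -/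
theorem hasNonsingularReductionAt_of_not_sq_dvd_Δ (hΔ : ¬ (ℓ : ℤ) ^ 2 ∣ V.Δ) {x y : ℚ}
    (h : (V.map (Int.castRingHom ℚ)).toAffine.Nonsingular x y) :
    (V.map (Int.castRingHom ℚ)).HasNonsingularReductionAt ℓ x y := by
  haveI : (V.map (Int.castRingHom ℚ)).IsIntegral ℤ := ⟨V, rfl⟩
  have hnorm : (ℓ : ℝ)⁻¹ ^ 2 < ‖(((V.map (Int.castRingHom ℚ)).Δ : ℚ) : ℚ_[ℓ])‖ := by
    rw [map_Δ, eq_intCast, Rat.cast_intCast]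
    have hlt := (Padic.norm_int_le_pow_iff_dvd V.Δ 2).not.mpr (by exact_mod_cast hΔ)
    rw [not_le] at hlt
    have e : (ℓ : ℝ)⁻¹ ^ 2 = (ℓ : ℝ) ^ (-(2 : ℕ) : ℤ) := by rw [zpow_neg, zpow_natCast, inv_pow]
    rw [e]; exact hlt
  have htop := (V.map (Int.castRingHom ℚ)).nonsingularReductionSubgroupAt_eq_top_of_lt_norm_Δ ℓ hnorm
  have hmem : (Affine.Point.some x y h : (V.map (Int.castRingHom ℚ)).toAffine.Point) ∈
      (V.map (Int.castRingHom ℚ)).nonsingularReductionSubgroupAt ℓ := by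
    rw [htop]; exact AddSubgroup.mem_top _
  exact ((V.map (Int.castRingHom ℚ)).reducesNonsingularlyAt_some ℓ h).mp
    ((mem_nonsingularReductionSubgroupAt_iff _).mp hmem)

/-- Square-free discriminant ⇒ non-singular reduction of every rational point at every prime.
[cite: SilvermanAEC2009, VII.2.1 and VII.6.1] -/
theorem hasNonsingularReductionAt_of_squarefree_Δ (hΔ : Squarefree V.Δ) {x y : ℚ}
    (h : (V.map (Int.castRingHom ℚ)).toAffine.Nonsingular x y) :
    (V.map (Int.castRingHom ℚ)).HasNonsingularReductionAt ℓ x y := by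
  refine V.hasNonsingularReductionAt_of_not_sq_dvd_Δ ℓ (fun hdvd => ?_) h
  have hu := hΔ (ℓ : ℤ) (by rw [← sq]; exact hdvd)
  rw [Int.isUnit_iff] at hu
  have h2 := (Fact.out : ℓ.Prime).two_le
  omega

end Sieve

/-! ### `n • P` in integer division values -/

section IntValues

variable (V : WeierstrassCurve ℤ) {a b : ℤ}

/-- `ωₙ` of the model over `ℚ` at an integral point is the integer `ωₙ(a, b) = ev_{(V; a, b)}(ωₙ)`
(naturality of the universal `ωₙ`, `UnivEC.map_ev`). [cite: SilvermanAEC2009, Exercise 3.7(b)] -/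
theorem ωEval_map_intCast (n : ℤ) :
    Affine.Point.ωEval (V.map (Int.castRingHom ℚ)) (a : ℚ) (b : ℚ) n =
      ((UnivEC.ev V a b (UnivEC.ω n) : ℤ) : ℚ) := by
  rw [Affine.Point.ωEval]
  exact (UnivEC.map_ev (Int.castRingHom ℚ) V a b (UnivEC.ω n)).symm

/-- **`n • P = (φₙ(P)/ψₙ(P)², ωₙ(P)/ψₙ(P)³)` with INTEGER division values** for an integral point
`P = (a, b)` of `V ⊗ ℚ` and `ψₙ(P) ≠ 0` (Silverman *AEC* Ex. 3.7(d), tree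
`Affine.Point.zsmul_some_eq_of_evalEval_ψ_ne_zero`, transported along `ℤ → ℚ`).
[cite: SilvermanAEC2009, Exercise 3.7(d)] -/
theorem Affine.Point.zsmul_some_intCast_eq
    (h : (V.map (Int.castRingHom ℚ)).toAffine.Nonsingular (a : ℚ) (b : ℚ)) {n : ℤ}
    (hψ : (V.ψ n).evalEval a b ≠ 0) :
    ∃ h₁ : (V.map (Int.castRingHom ℚ)).toAffine.Nonsingular
        ((((V.φ n).evalEval a b : ℤ) : ℚ) / (((V.ψ n).evalEval a b : ℤ) : ℚ) ^ 2)
        (((UnivEC.ev V a b (UnivEC.ω n) : ℤ) : ℚ) / (((V.ψ n).evalEval a b : ℤ) : ℚ) ^ 3),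
      n • Affine.Point.some _ _ h = Affine.Point.some _ _ h₁ := by
  have hψ' : ((V.map (Int.castRingHom ℚ)).ψ n).evalEval (a : ℚ) (b : ℚ) ≠ 0 := by
    rw [evalEval_ψ_map_intCast]; exact_mod_cast hψ
  obtain ⟨hns, e⟩ := Affine.Point.zsmul_some_eq_of_evalEval_ψ_ne_zero h hψ'
  obtain ⟨h₁, e₁⟩ := UnivEC.some_eq_some_of_eq (W := V.map (Int.castRingHom ℚ))
    (by rw [evalEval_φ_map_intCast, evalEval_ψ_map_intCast])
    (by rw [ωEval_map_intCast, evalEval_ψ_map_intCast]) hns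
  exact ⟨h₁, e.trans e₁⟩

/-- `n • P = O ↔ ψₙ(P) = 0` for an integral point `P = (a, b)`, on the INTEGER division value
(`Affine.Point.zsmul_some_eq_zero_iff` transported along `ℤ → ℚ`). [cite: SilvermanAEC2009, Exercise 3.7(d)] -/
theorem Affine.Point.zsmul_some_intCast_eq_zero_iff
    (h : (V.map (Int.castRingHom ℚ)).toAffine.Nonsingular (a : ℚ) (b : ℚ)) (n : ℤ) :
    n • Affine.Point.some _ _ h = 0 ↔ (V.ψ n).evalEval a b = 0 := by
  rw [Affine.Point.zsmul_some_eq_zero_iff h n, evalEval_ψ_map_intCast, Int.cast_eq_zero]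

/-- **The exact numerator `num x(nP) = φₙ(P)`** for an integral point `P = (a, b)` with non-singular
reduction at every prime dividing `ψₙ(P) ≠ 0` (`φₙ(P)` and `ψₙ(P)` are coprime by Ayad's lemma,
`isCoprime_evalEval_φ_ψ`; companion of the exact denominator `den x(nP) = ψₙ(P)²`,
`Affine.Point.exists_zsmul_eq_and_den_eq_sq`). [cite: Stange2016, §10 Lemma 29 and its proof] -/
theorem num_φ_div_ψ_sq_eq (h : (V.map (Int.castRingHom ℚ)).toAffine.Nonsingular (a : ℚ) (b : ℚ))
    {n : ℤ} (hψ : (V.ψ n).evalEval a b ≠ 0)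
    (hred : ∀ (ℓ : ℕ) [Fact ℓ.Prime], (ℓ : ℤ) ∣ (V.ψ n).evalEval a b →
      (V.map (Int.castRingHom ℚ)).HasNonsingularReductionAt ℓ a b) :
    ((((V.φ n).evalEval a b : ℤ) : ℚ) / (((V.ψ n).evalEval a b : ℤ) : ℚ) ^ 2).num =
      (V.φ n).evalEval a b := by
  have hn : n ≠ 0 := by rintro rfl; simp [ψ_zero] at hψ
  have hcop : IsCoprime ((V.φ n).evalEval a b) ((V.ψ n).evalEval a b ^ 2) :=
    (V.isCoprime_evalEval_φ_ψ h hn hred).pow_right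
  have hpos : 0 < (V.ψ n).evalEval a b ^ 2 := by positivity
  have := Rat.num_div_eq_of_coprime hpos (Int.isCoprime_iff_nat_coprime.mp hcop)
  push_cast at this
  exact this

/-- The exact denominator in the integer normal form used here: `den x(nP) = ψₙ(P)²`
(`Affine.Point.exists_zsmul_eq_and_den_eq_sq`, restated on the integer quotient).
[cite: Stange2016, §10 Lemma 29 and its proof] -/
theorem den_φ_div_ψ_sq_eq (h : (V.map (Int.castRingHom ℚ)).toAffine.Nonsingular (a : ℚ) (b : ℚ))
    {n : ℤ} (hψ : (V.ψ n).evalEval a b ≠ 0)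
    (hred : ∀ (ℓ : ℕ) [Fact ℓ.Prime], (ℓ : ℤ) ∣ (V.ψ n).evalEval a b →
      (V.map (Int.castRingHom ℚ)).HasNonsingularReductionAt ℓ a b) :
    (((((V.φ n).evalEval a b : ℤ) : ℚ) / (((V.ψ n).evalEval a b : ℤ) : ℚ) ^ 2).den : ℤ) =
      (V.ψ n).evalEval a b ^ 2 := by
  have hn : n ≠ 0 := by rintro rfl; simp [ψ_zero] at hψ
  have hcop : IsCoprime ((V.φ n).evalEval a b) ((V.ψ n).evalEval a b ^ 2) :=
    (V.isCoprime_evalEval_φ_ψ h hn hred).pow_right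
  have hpos : 0 < (V.ψ n).evalEval a b ^ 2 := by positivity
  have := Rat.den_div_eq_of_coprime hpos (Int.isCoprime_iff_nat_coprime.mp hcop)
  push_cast at this
  exact this

end IntValues

/-! ### At a prime `p ∣ ψₙ(P)`: units, the parameter `z(nP) = −φₙψₙ/ωₙ`, admissibility -/

section Padic

variable (V : WeierstrassCurve ℤ) {a b : ℤ} (p : ℕ) [Fact p.Prime]

/-- **`p ∣ ψₙ(P)` ⇒ `φₙ(P), ωₙ(P)` are `p`-adic units** for an integral point `P = (a, b)` with
non-singular reduction at `p` and `n ≠ 0` (Ayad's lemma at `p`, `norm_evalEval_φ_eq_one_of_norm_evalEval_ψ_lt_one`,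
on the integer division values). [cite: Stange2016, §5 proof of Thm 12] -/
theorem norm_intCast_φ_eq_one_of_dvd_ψ
    (h : (V.map (Int.castRingHom ℚ)).toAffine.Nonsingular (a : ℚ) (b : ℚ))
    (hred : (V.map (Int.castRingHom ℚ)).HasNonsingularReductionAt p a b) {n : ℤ} (hn : n ≠ 0)
    (hp : (p : ℤ) ∣ (V.ψ n).evalEval a b) :
    ‖(((V.φ n).evalEval a b : ℤ) : ℚ_[p])‖ = 1 ∧ ‖((UnivEC.ev V a b (UnivEC.ω n) : ℤ) : ℚ_[p])‖ = 1 := by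
  haveI : (V.map (Int.castRingHom ℚ)).IsIntegral ℤ := ⟨V, rfl⟩
  have hx : ‖((a : ℚ) : ℚ_[p])‖ ≤ 1 := by rw [Rat.cast_intCast]; exact Padic.norm_int_le_one a
  have hψn : ‖((((V.map (Int.castRingHom ℚ)).ψ n).evalEval (a : ℚ) (b : ℚ) : ℚ) : ℚ_[p])‖ < 1 := by
    rw [evalEval_ψ_map_intCast, Rat.cast_intCast]
    exact Padic.norm_intCast_lt_one_iff.mpr hp
  obtain ⟨hφ, hω⟩ := (V.map (Int.castRingHom ℚ)).norm_evalEval_φ_eq_one_of_norm_evalEval_ψ_lt_one p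
    h hx hred hn hψn
  rw [evalEval_φ_map_intCast, Rat.cast_intCast] at hφ
  rw [ωEval_map_intCast, Rat.cast_intCast] at hω
  exact ⟨hφ, hω⟩

/-- **`‖x(nP)‖_p = ‖ψₙ(P)‖_p⁻² > 1`** when `p ∣ ψₙ(P) ≠ 0` (so `nP ∈ E₁(ℚ_p)`): the `p`-part of the
exact denominator. [cite: Stange2016, §10 proof of Lemma 29 ("In this case, v(W_n) = v(D_n)")] -/
theorem norm_x_zsmul_eq (h : (V.map (Int.castRingHom ℚ)).toAffine.Nonsingular (a : ℚ) (b : ℚ))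
    (hred : (V.map (Int.castRingHom ℚ)).HasNonsingularReductionAt p a b) {n : ℤ}
    (hψ : (V.ψ n).evalEval a b ≠ 0) (hp : (p : ℤ) ∣ (V.ψ n).evalEval a b) :
    ‖(((((V.φ n).evalEval a b : ℤ) : ℚ) / (((V.ψ n).evalEval a b : ℤ) : ℚ) ^ 2 : ℚ) : ℚ_[p])‖ =
        ‖(((V.ψ n).evalEval a b : ℤ) : ℚ_[p])‖⁻¹ ^ 2 ∧
      1 < ‖(((((V.φ n).evalEval a b : ℤ) : ℚ) / (((V.ψ n).evalEval a b : ℤ) : ℚ) ^ 2 : ℚ) : ℚ_[p])‖ := by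
  have hn : n ≠ 0 := by rintro rfl; simp [ψ_zero] at hψ
  obtain ⟨hφ, -⟩ := V.norm_intCast_φ_eq_one_of_dvd_ψ p h hred hn hp
  have hψ1 : ‖(((V.ψ n).evalEval a b : ℤ) : ℚ_[p])‖ < 1 := Padic.norm_intCast_lt_one_iff.mpr hp
  have hψ0 : 0 < ‖(((V.ψ n).evalEval a b : ℤ) : ℚ_[p])‖ := by
    rw [norm_pos_iff]; exact_mod_cast hψ
  have e : ‖(((((V.φ n).evalEval a b : ℤ) : ℚ) / (((V.ψ n).evalEval a b : ℤ) : ℚ) ^ 2 : ℚ) : ℚ_[p])‖ =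
      ‖(((V.ψ n).evalEval a b : ℤ) : ℚ_[p])‖⁻¹ ^ 2 := by
    push_cast
    rw [norm_div, norm_pow, hφ, one_div, inv_pow]
  refine ⟨e, ?_⟩
  rw [e, inv_pow]
  exact one_lt_inv_iff₀.mpr ⟨by positivity, pow_lt_one₀ hψ0.le hψ1 two_ne_zero⟩

/-- **The parameter of `nP`: `z(nP) = −x(nP)/y(nP) = −φₙ(P)ψₙ(P)/ωₙ(P)`** (in `ℚ_p`), for
`p ∣ ψₙ(P) ≠ 0` and `P` with non-singular reduction at `p` (so that `ωₙ(P)` is a unit, in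
particular non-zero). [cite: Stange2016, §5 proof of Thm 12] -/
theorem padicParam_zsmul_eq (h : (V.map (Int.castRingHom ℚ)).toAffine.Nonsingular (a : ℚ) (b : ℚ))
    (hred : (V.map (Int.castRingHom ℚ)).HasNonsingularReductionAt p a b) {n : ℤ}
    (hψ : (V.ψ n).evalEval a b ≠ 0) (hp : (p : ℤ) ∣ (V.ψ n).evalEval a b) :
    -(((((V.φ n).evalEval a b : ℤ) : ℚ) / (((V.ψ n).evalEval a b : ℤ) : ℚ) ^ 2 : ℚ) : ℚ_[p]) /
        ((((UnivEC.ev V a b (UnivEC.ω n) : ℤ) : ℚ) / (((V.ψ n).evalEval a b : ℤ) : ℚ) ^ 3 : ℚ) : ℚ_[p]) =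
      -((((V.φ n).evalEval a b : ℤ) : ℚ_[p]) * (((V.ψ n).evalEval a b : ℤ) : ℚ_[p]) /
        ((UnivEC.ev V a b (UnivEC.ω n) : ℤ) : ℚ_[p])) := by
  have hn : n ≠ 0 := by rintro rfl; simp [ψ_zero] at hψ
  obtain ⟨-, hω⟩ := V.norm_intCast_φ_eq_one_of_dvd_ψ p h hred hn hp
  have hω0 : ((UnivEC.ev V a b (UnivEC.ω n) : ℤ) : ℚ_[p]) ≠ 0 := by
    rw [← norm_pos_iff, hω]; exact one_pos
  have hψ0 : (((V.ψ n).evalEval a b : ℤ) : ℚ_[p]) ≠ 0 := by exact_mod_cast hψ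
  push_cast
  field_simp

/-- **`‖z(nP)‖_p = ‖ψₙ(P)‖_p`** (`v(Θ([n]P)) = v(Ψₙ(P))`): the level of `nP` in the `p`-adic
filtration is `v_p(ψₙ(P))`. [cite: Stange2016, §5 proof of Thm 12 ("v(Θ([kn_P]P)) = v(−φψ/ω) = v(Ψ_{kn_P})")] -/
theorem norm_padicParam_zsmul_eq (h : (V.map (Int.castRingHom ℚ)).toAffine.Nonsingular (a : ℚ) (b : ℚ))
    (hred : (V.map (Int.castRingHom ℚ)).HasNonsingularReductionAt p a b) {n : ℤ} (hn : n ≠ 0)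
    (hp : (p : ℤ) ∣ (V.ψ n).evalEval a b) :
    ‖-((((V.φ n).evalEval a b : ℤ) : ℚ_[p]) * (((V.ψ n).evalEval a b : ℤ) : ℚ_[p]) /
        ((UnivEC.ev V a b (UnivEC.ω n) : ℤ) : ℚ_[p]))‖ = ‖(((V.ψ n).evalEval a b : ℤ) : ℚ_[p])‖ := by
  obtain ⟨hφ, hω⟩ := V.norm_intCast_φ_eq_one_of_dvd_ψ p h hred hn hp
  rw [norm_neg, norm_div, norm_mul, hφ, hω, one_mul, div_one]

/-- **`nP` is admissible for the sigma formula** (`WeierstrassCurve.IsAdmissible`: non-torsion,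
`‖x(nP)‖_p > 1`, `z(nP)` in the sigma disc, non-singular reduction at every prime) as soon as
`p ≥ 3`, `p ∣ ψₙ(P) ≠ 0` and `Δ(V)` is divisible by the square of no prime (then EVERY rational point
reduces non-singularly everywhere, `hasNonsingularReductionAt_of_not_sq_dvd_Δ`). This is step 1 of
Mazur–Stein–Tate's algorithm («compute `m` such that `mP` reduces to `O ∈ E(𝔽_p)` and to the connected
component of `E_{𝔽_ℓ}` at all bad primes») certified by the division value `ψₙ(P)`.
[cite: MazurSteinTate2006, §1 and Alg. 3.4 (step 1)] -/
theorem isAdmissible_zsmul_of_dvd_ψ (hp3 : 3 ≤ p)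
    (h : (V.map (Int.castRingHom ℚ)).toAffine.Nonsingular (a : ℚ) (b : ℚ))
    (hΔ : ∀ ℓ : ℕ, ℓ.Prime → ¬ (ℓ : ℤ) ^ 2 ∣ V.Δ) {n : ℤ}
    (hψ : (V.ψ n).evalEval a b ≠ 0) (hp : (p : ℤ) ∣ (V.ψ n).evalEval a b) :
    (V.map (Int.castRingHom ℚ)).IsAdmissible p (n • Affine.Point.some _ _ h) := by
  haveI : (V.map (Int.castRingHom ℚ)).IsIntegral ℤ := ⟨V, rfl⟩
  have hredp : (V.map (Int.castRingHom ℚ)).HasNonsingularReductionAt p a b :=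
    V.hasNonsingularReductionAt_of_not_sq_dvd_Δ p (hΔ p Fact.out) h
  obtain ⟨h₁, e⟩ := Affine.Point.zsmul_some_intCast_eq V h hψ
  rw [e]
  exact (V.map (Int.castRingHom ℚ)).isAdmissible_of_one_lt_norm hp3 h₁
    (V.norm_x_zsmul_eq p h hredp hψ hp).2
    fun ℓ hℓ => by haveI := Fact.mk hℓ; exact V.hasNonsingularReductionAt_of_not_sq_dvd_Δ ℓ (hΔ ℓ hℓ) h₁

end Padic

/-! ### The canonical datum on `n • P` -/

section Canonical

variable {p : ℕ} [Fact p.Prime]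

/-- **`n² ⟨P, P⟩ = ⟨nP, nP⟩`** for any `p`-adic height datum (bilinearity; Mazur–Stein–Tate's
`h_p(P) = h_p(mP)/m²`, step 4 of Alg. 3.4). [cite: MazurSteinTate2006, §1 and Alg. 3.4 (step 4)] -/
theorem PAdicHeightData.sq_mul_pairing_self_eq {W : WeierstrassCurve ℚ} (D : PAdicHeightData W p)
    (n : ℤ) (P : W.toAffine.Point) :
    ((n : ℚ_[p]) ^ 2) * D.pairing P P = D.pairing (n • P) (n • P) := by
  rw [map_zsmul (D.pairing (n • P)) n P, D.symm (n • P) P, map_zsmul (D.pairing P) n P, smul_smul,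
    zsmul_eq_mul, Int.cast_mul, sq]

variable (V : WeierstrassCurve ℤ) {a b : ℤ} (p)

/-- **The sigma formula for `⟨nP, nP⟩` in division values.** Let `V/ℤ` be an integral model whose
discriminant is divisible by the square of no prime, `P = (a, b)` an integral point of `E = V ⊗ ℚ`,
`p ≥ 3`, and `n` with `p ∣ ψₙ(P) ≠ 0`. Then for THE canonical `p`-adic height datum `D`
(`PAdicHeightData.IsCanonical`, Stein–Wuthrich normalisation `ĥ_p = log_p den x − 2 log_p σ_p(z)`):

  `⟨nP, nP⟩_D = log_p(ψₙ(P)²) − 2 · log_p σ_p(−φₙ(P)ψₙ(P)/ωₙ(P))`,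

i.e. Mazur–Stein–Tate's `d(nP) = |ψₙ(P)|` and `s = σ_p(−x/y)` with `−x/y = −φₙψₙ/ωₙ`.
[cite: MazurSteinTate2006, §1 eq. (1.1) and Alg. 3.4 (steps 2–4)] -/
theorem pairing_zsmul_self_eq_of_isCanonical (hp3 : 3 ≤ p)
    {D : PAdicHeightData (V.map (Int.castRingHom ℚ)) p} (hD : D.IsCanonical)
    (h : (V.map (Int.castRingHom ℚ)).toAffine.Nonsingular (a : ℚ) (b : ℚ))
    (hΔ : ∀ ℓ : ℕ, ℓ.Prime → ¬ (ℓ : ℤ) ^ 2 ∣ V.Δ) {n : ℤ}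
    (hψ : (V.ψ n).evalEval a b ≠ 0) (hp : (p : ℤ) ∣ (V.ψ n).evalEval a b) :
    D.pairing (n • Affine.Point.some _ _ h) (n • Affine.Point.some _ _ h) =
      padicLog p ((((V.ψ n).evalEval a b : ℤ) : ℚ_[p]) ^ 2) -
        2 * padicLog p ((V.map (Int.castRingHom ℚ)).padicSigmaEval p
          (-((((V.φ n).evalEval a b : ℤ) : ℚ_[p]) * (((V.ψ n).evalEval a b : ℤ) : ℚ_[p]) /
            ((UnivEC.ev V a b (UnivEC.ω n) : ℤ) : ℚ_[p])))) := by
  have hred : ∀ (ℓ : ℕ) [Fact ℓ.Prime], (V.map (Int.castRingHom ℚ)).HasNonsingularReductionAt ℓ a b :=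
    fun ℓ _ => V.hasNonsingularReductionAt_of_not_sq_dvd_Δ ℓ (hΔ ℓ Fact.out) h
  have hadm := V.isAdmissible_zsmul_of_dvd_ψ p hp3 h hΔ hψ hp
  obtain ⟨h₁, e⟩ := Affine.Point.zsmul_some_intCast_eq V h hψ
  rw [e] at hadm ⊢
  rw [hD _ hadm]
  set X : ℚ := (((V.φ n).evalEval a b : ℤ) : ℚ) / (((V.ψ n).evalEval a b : ℤ) : ℚ) ^ 2 with hX
  have hd : (X.den : ℤ) = (V.ψ n).evalEval a b ^ 2 := V.den_φ_div_ψ_sq_eq h hψ (fun ℓ _ _ => hred ℓ)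
  have hden : ((X.den : ℚ) : ℚ_[p]) = (((V.ψ n).evalEval a b : ℤ) : ℚ_[p]) ^ 2 := by
    have hd' : (X.den : ℚ) = (((V.ψ n).evalEval a b ^ 2 : ℤ) : ℚ) := by rw [← hd, Int.cast_natCast]
    rw [hd']; push_cast; ring
  rw [canonicalPAdicHeight, hden, V.padicParam_zsmul_eq p h (hred p) hψ hp]

/-- **First-order form: `‖⟨nP, nP⟩_D − log_p φₙ(P)‖_p ≤ ‖ψₙ(P)‖_p`** (same hypotheses; `num x(nP) = φₙ(P)`
and `‖z(nP)‖ = ‖ψₙ(P)‖` in the tree's `‖ĥ_p(Q) − log_p num x(Q)‖ ≤ ‖z(Q)‖`, Harvey 2008 §5). In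
particular `⟨nP, nP⟩ ≡ log_p φₙ(P)` modulo `p^{v_p(ψₙ(P))} ℤ_p`.
[cite: Harvey2008, §5 (evaluation of log_p(σ_p(mQ)/d(mQ)); Lemma 8)] -/
theorem norm_pairing_zsmul_self_sub_padicLog_φ_le (hp3 : 3 ≤ p)
    {D : PAdicHeightData (V.map (Int.castRingHom ℚ)) p} (hD : D.IsCanonical)
    (h : (V.map (Int.castRingHom ℚ)).toAffine.Nonsingular (a : ℚ) (b : ℚ))
    (hΔ : ∀ ℓ : ℕ, ℓ.Prime → ¬ (ℓ : ℤ) ^ 2 ∣ V.Δ) {n : ℤ}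
    (hψ : (V.ψ n).evalEval a b ≠ 0) (hp : (p : ℤ) ∣ (V.ψ n).evalEval a b) :
    ‖D.pairing (n • Affine.Point.some _ _ h) (n • Affine.Point.some _ _ h) -
        padicLog p (((V.φ n).evalEval a b : ℤ) : ℚ_[p])‖ ≤ ‖(((V.ψ n).evalEval a b : ℤ) : ℚ_[p])‖ := by
  haveI : (V.map (Int.castRingHom ℚ)).IsIntegral ℤ := ⟨V, rfl⟩
  have hp2 : p ≠ 2 := by omega
  have hn : n ≠ 0 := by rintro rfl; simp [ψ_zero] at hψ
  have hred : ∀ (ℓ : ℕ) [Fact ℓ.Prime], (V.map (Int.castRingHom ℚ)).HasNonsingularReductionAt ℓ a b :=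
    fun ℓ _ => V.hasNonsingularReductionAt_of_not_sq_dvd_Δ ℓ (hΔ ℓ Fact.out) h
  have hadm := V.isAdmissible_zsmul_of_dvd_ψ p hp3 h hΔ hψ hp
  obtain ⟨h₁, e⟩ := Affine.Point.zsmul_some_intCast_eq V h hψ
  rw [e] at hadm ⊢
  have key := PAdicHeightData.IsCanonical.norm_pairing_self_sub_padicLog_num_le _ p hD hp2 hadm
  rw [V.num_φ_div_ψ_sq_eq h hψ (fun ℓ _ _ => hred ℓ)] at key
  refine key.trans_eq ?_
  rw [← norm_neg, ← neg_div, V.padicParam_zsmul_eq p h (hred p) hψ hp,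
    V.norm_padicParam_zsmul_eq p h (hred p) hn hp]

end Canonical

end WeierstrassCurve

end
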